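import Summits.ResolutionOfSingularities.ResolutionOfSingularities.Theorems.HilbertSamuelEliminationSigmaMaxModificationsCorridor3WLadderLocalPointBlowup
import Literature.AlgebraicGeometry.Resolution.BlowupsLocal
import Mathlib.Algebra.Category.Ring.Instances
import HarnessLib

/-!
# [OURS · L1 W4.2] Blow-ups of the closed points of isomorphic local schemes agree; the LOCAL STEP of a moving chain
# transported to an abstract tower — grade 1 / units-half of `stub_Wlow3M_char`
# (crux chain w42, line `w_ladder`; `--supports stmt-ResolutionOfSingularities-19249`, helper)

OURS (cell res-hironaka, slot W4.2, seat res-L1-w42-stub-2 gen 3); NOT statements of H. Hironaka's manuscript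
[Hironaka2017]. AI-drafted, weaker than expert review. Sorry-free PROOF file (no new definition), fact-free scheme
bookkeeping continuing `…Corridor3WLadderLocalPointBlowup.lean` — the comparison step (LC) of the local fundamental
sequence / unit attached to a moving chain (CJS p. 107 «depend only on the localization `X_x = Spec(𝒪_{X,x})`»;
res-type-053 05:51:28Z: «it IS T1 + `IsBlowup.unique` … yours to assemble»):

* `Moving.exists_iso_of_isBlowup_point_of_iso` — **(LC)** for an isomorphism `e : 𝒪_{X,x} ≅ 𝒪_{Y,y}`-level datum given as
  an iso of AFFINE LOCAL SCHEMES `A ≅ B` (`CommRingCat` iso of local rings) and blow-ups `p : P → Spec A`, `q : Q → Spec B`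
  of the closed points (as «the point over» form, `vanishingIdeal {c}`), there is `Φ : P ≅ Q` over `Spec e⁻¹`
  (transport `IsBlowup.comp_iso` + uniqueness `IsBlowup.unique`).
* `Moving.exists_localStep` — **THE LOCAL STEP**: `Y` a scheme with a CLOSED point `y` and an iso of local rings
  `𝒪_{Y,y} ≅ 𝒪_{X,x}`; `π : X' → X` a blow-up in a centre `C = 𝓘(V(C))` with `C_x = 𝔪_x` (e.g. THE canonical centre at a
  blown-up marked point with `e ≤ 1`, `…Corridor3WLadderBlownUpCentre`); `πY : Y' → Y` a blow-up in the reduced point `y`.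
  Then every `x' ∈ X'` over `x` has a partner `y' ∈ Y'` over `y` WITH ISOMORPHIC LOCAL RING `𝒪_{Y',y'} ≅ 𝒪_{X',x'}` —
  so `H^N`, `e`, `ē`, near-ness are the same at `y'` and `x'` (CJS Lemma 2.27 / Def. 2.26 / Def. 2.28 depend only on the
  local ring). Both blow-ups base-changed to `Spec` of the (isomorphic) local rings are the blow-ups of the closed
  points (`isBlowup_pullback_snd_fromSpecStalk_singleton`), hence isomorphic by (LC); points over the closed point lift
  and descend along the pro-open projections, which induce isomorphisms of local rings.

This is the recursion step of the tower `T` over `Spec 𝒪_{X_{n_0},x_{n_0}}` realising the genuine steps of a moving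
chain as a fundamental sequence (Def. 6.34, grade `e = 1`, Cor. 6.37) or unit (Def. 6.38, `e = 2`, Thm. 6.40).

## References

* V. Cossart, U. Jannsen, S. Saito, LNM 2270 (2020): p. 107, Lemma 2.27, Def. 6.34, Def. 6.38, Cor. 6.37. [CossartJannsenSaito2020]
* U. Görtz, T. Wedhorn, *Algebraic Geometry I* (2nd ed. 2020), Def. 13.90, Prop. 13.91. [GortzWedhorn2020]
* The Stacks Project, Tags 01J7, 0805. [StacksProject]
-/

noncomputable section

-- namespace `…Corridor3.Moving` re-enters `…Corridor3` (module convention of the Moving files)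
set_option linter.dupNamespace false

open CategoryTheory CategoryTheory.Limits AlgebraicGeometry TopologicalSpace IsLocalRing
open Literature.AlgebraicGeometry.Resolution Literature.RingTheory.HilbertSamuel
open Scheme.IdealSheafData

universe u

open Literature.AlgebraicGeometry.CossartJannsenSaito2020

namespace Summit.ResolutionOfSingularities.ResolutionOfSingularities.Theorems.SigmaMaxModificationsCorridor3.Moving

/-! ## (LC) Blow-ups of the closed points of isomorphic local schemes -/

/-- The scheme isomorphism `Spec A ≅ Spec B` of an isomorphism of rings `e : A ≅ B` (`hom = Spec e⁻¹`, `inv = Spec e`).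
[folklore] -/
theorem exists_specIso {A B : CommRingCat.{u}} (e : A ≅ B) :
    ∃ ε : Spec A ≅ Spec B, ε.hom = Spec.map e.inv ∧ ε.inv = Spec.map e.hom := by
  refine ⟨⟨Spec.map e.inv, Spec.map e.hom, ?_, ?_⟩, rfl, rfl⟩
  · rw [← Spec.map_comp, e.hom_inv_id, Spec.map_id]
  · rw [← Spec.map_comp, e.inv_hom_id, Spec.map_id]

/-- `Spec e : Spec B → Spec A` maps the closed point to the closed point (an isomorphism of local rings is local).
[folklore] -/
theorem specMap_closedPoint_of_iso {A B : CommRingCat.{u}} [IsLocalRing A] [IsLocalRing B] (e : A ≅ B) :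
    (Spec.map e.hom).base (closedPoint B) = closedPoint A := by
  haveI : IsLocalHom e.hom.hom := isLocalHom_of_iso e
  exact Spec_closedPoint

/-- **(LC) Blow-ups of the closed points of isomorphic local schemes are isomorphic over the base isomorphism**:
for `e : A ≅ B` (local rings), `p : P → Spec A` a blow-up of `{𝔪_A}` and `q : Q → Spec B` a blow-up of `{𝔪_B}` (both
reduced points, given as points `cA`, `cB` equal to the closed points), there is `Φ : P ≅ Q` with `Φ ≫ q = p ≫ Spec e⁻¹`.
(`IsBlowup.comp_iso`: `p ≫ Spec e⁻¹` is a blow-up of `Spec B` in `(Spec e)⁻¹{𝔪_A} = {𝔪_B}`; `IsBlowup.unique`.)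
[cite: GortzWedhorn2020, Def. 13.90] -/
theorem exists_iso_of_isBlowup_point_of_iso {A B : CommRingCat.{u}} [IsLocalRing A] [IsLocalRing B] (e : A ≅ B)
    {P Q : Scheme.{u}} {p : P ⟶ Spec A} {q : Q ⟶ Spec B}
    {cA : ↥(Spec A)} (hcA : cA = closedPoint A) (hA : IsClosed ({cA} : Set ↥(Spec A)))
    {cB : ↥(Spec B)} (hcB : cB = closedPoint B) (hB : IsClosed ({cB} : Set ↥(Spec B)))
    (hp : IsBlowup p (vanishingIdeal ⟨{cA}, hA⟩)) (hq : IsBlowup q (vanishingIdeal ⟨{cB}, hB⟩)) :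
    ∃ Φ : P ≅ Q, Φ.hom ≫ q = p ≫ Spec.map e.inv := by
  obtain ⟨ε, hεhom, hεinv⟩ := exists_specIso e
  have hp' := hp.comp_iso ε
  -- the moved centre is the closed point of `Spec B`
  have hI : (vanishingIdeal (⟨{cA}, hA⟩ : Closeds ↥(Spec A))).comap ε.inv =
      vanishingIdeal (⟨{cB}, hB⟩ : Closeds ↥(Spec B)) := by
    rw [comap_vanishingIdeal_eq_of_flat_of_isPreimmersion]
    congr 1
    ext z
    rw [Closeds.coe_preimage, Closeds.coe_mk, Set.mem_preimage, Set.mem_singleton_iff, Closeds.coe_mk,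
      Set.mem_singleton_iff, hcA, hcB, hεinv]
    constructor
    · intro h
      apply (Spec.map e.hom).isEmbedding.injective
      rw [h, specMap_closedPoint_of_iso e]
    · rintro rfl
      exact specMap_closedPoint_of_iso e
  rw [hI] at hp'
  obtain ⟨Φ, hΦ, -⟩ := hp'.unique hq
  exact ⟨Φ, by rw [hΦ, hεhom]⟩

/-! ## The local step -/

/-- The support of the ideal of a closed set is the set. [folklore] -/
theorem vanishingIdeal_eq_vanishingIdeal_support {Y : Scheme.{u}} (Z : Closeds Y) :
    vanishingIdeal Z = vanishingIdeal (vanishingIdeal Z).support := by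
  have h : (vanishingIdeal Z).support = Z := Closeds.ext (Scheme.IdealSheafData.coe_support_vanishingIdeal Z)
  rw [h]

/-- **THE LOCAL STEP of a moving chain transported to an abstract tower.** Let `y ∈ Y` be a closed point with an
isomorphism of local rings `𝒪_{Y,y} ≅ 𝒪_{X,x}`, `π : X' → X` a blow-up in a centre `C = 𝓘(V(C))` with `C_x = 𝔪_x`, and
`πY : Y' → Y` a blow-up in the reduced point `y`. Then every `x' ∈ X'` over `x` has a partner `y' ∈ Y'` over `y` with
`𝒪_{Y',y'} ≅ 𝒪_{X',x'}`. [cite: CossartJannsenSaito2020, p. 107, Def. 6.34 (i)] [cite: GortzWedhorn2020, Prop. 13.91 (2)] -/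
theorem exists_localStep {Y Y' X X' : Scheme.{u}} {y : Y} (hy : IsClosed ({y} : Set Y)) {πY : Y' ⟶ Y}
    (hπY : IsBlowup πY (vanishingIdeal ⟨{y}, hy⟩)) {π : X' ⟶ X} {C : X.IdealSheafData} (hπ : IsBlowup π C)
    (hC : C = vanishingIdeal C.support) {x : X} (hx : stalkIdeal C x = maximalIdeal (X.presheaf.stalk x))
    (e : Y.presheaf.stalk y ≅ X.presheaf.stalk x) {x' : X'} (hx' : π.base x' = x) :
    ∃ y' : Y', πY.base y' = y ∧ Nonempty (Y'.presheaf.stalk y' ≅ X'.presheaf.stalk x') := by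
  -- both sides, base-changed to `Spec` of the local rings, are blow-ups of the closed points
  have hCY : vanishingIdeal (⟨{y}, hy⟩ : Closeds Y) = vanishingIdeal (vanishingIdeal (⟨{y}, hy⟩ : Closeds Y)).support :=
    vanishingIdeal_eq_vanishingIdeal_support _
  have hxY : stalkIdeal (vanishingIdeal (⟨{y}, hy⟩ : Closeds Y)) y = maximalIdeal (Y.presheaf.stalk y) :=
    stalkIdeal_vanishingIdeal_singleton hy
  have hcY : (Y.fromSpecStalk y).base (closedPoint (Y.presheaf.stalk y)) = y := Scheme.fromSpecStalk_closedPoint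
  have hcX : (X.fromSpecStalk x).base (closedPoint (X.presheaf.stalk x)) = x := Scheme.fromSpecStalk_closedPoint
  have hT := isBlowup_pullback_snd_fromSpecStalk_singleton hπY hCY hxY hcY
  have hW := isBlowup_pullback_snd_fromSpecStalk_singleton hπ hC hx hcX
  obtain ⟨Φ, hΦ⟩ := exists_iso_of_isBlowup_point_of_iso e rfl (isClosed_singleton_of_fromSpecStalk_eq hcY)
    rfl (isClosed_singleton_of_fromSpecStalk_eq hcX) hT hW
  -- lift `x'` to the `X`-side local blow-up, move across `Φ`, descend to `Y'`
  obtain ⟨zX, hzX, hzXc, hisoX⟩ := exists_lift_pullback_fromSpecStalk π x hx'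
  subst hzX
  set zY : ↥(pullback πY (Y.fromSpecStalk y)) := Φ.inv.base zX with hzY
  have hid : Φ.hom.base zY = zX := by
    have h1 := congrArg (fun f => f.base zX) Φ.inv_hom_id
    simp only [Scheme.Hom.comp_base, TopCat.coe_comp, Function.comp_apply] at h1
    rw [hzY, h1]
    rfl
  refine ⟨(pullback.fst πY (Y.fromSpecStalk y)).base zY, ?_, ?_⟩
  · -- over `y`: chase the closed points
    have hsq : (pullback.snd π (X.fromSpecStalk x)).base zX =
        (Spec.map e.inv).base ((pullback.snd πY (Y.fromSpecStalk y)).base zY) := by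
      have h := congrArg (fun f => f.base zY) hΦ
      simp only [Scheme.Hom.comp_base, TopCat.coe_comp, Function.comp_apply] at h
      rw [hid] at h
      exact h
    have hzXc' : (pullback.snd π (X.fromSpecStalk x)).base zX = closedPoint (X.presheaf.stalk x) :=
      eq_closedPoint_of_fromSpecStalk_eq hzXc
    have hzYc : (pullback.snd πY (Y.fromSpecStalk y)).base zY = closedPoint (Y.presheaf.stalk y) := by
      apply (Spec.map e.inv).isEmbedding.injective
      rw [← hsq, hzXc']
      haveI : IsLocalHom e.inv.hom := isLocalHom_of_iso e.symm
      exact Spec_closedPoint.symm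
    have hcond := congrArg (fun f => f.base zY) (pullback.condition (f := πY) (g := Y.fromSpecStalk y))
    simp only [Scheme.Hom.comp_base, TopCat.coe_comp, Function.comp_apply] at hcond
    rw [hcond, hzYc, Scheme.fromSpecStalk_closedPoint]
  · haveI := isIso_stalkMap_pullback_fst_fromSpecStalk πY y zY
    haveI := hisoX
    -- `𝒪_{Y',y'} ≅ 𝒪_{P_Y,zY} ≅ 𝒪_{P_X,zX} ≅ 𝒪_{X',x'}`
    exact ⟨asIso ((pullback.fst πY (Y.fromSpecStalk y)).stalkMap zY) ≪≫ asIso (Φ.inv.stalkMap zX) ≪≫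
      (asIso ((pullback.fst π (X.fromSpecStalk x)).stalkMap zX)).symm⟩


/-! ## The local step with CLOSEDNESS of the partner point (needed for the next blow-up centre `{y'}`) -/

/-- A closed point specialises only to itself. [folklore] -/
theorem eq_of_specializes_of_isClosed {Y : Type u} [TopologicalSpace Y] {y w : Y} (hy : IsClosed ({y} : Set Y))
    (h : y ⤳ w) : w = y := by
  have hw : w ∈ closure ({y} : Set Y) := h.mem_closure
  rw [hy.closure_eq] at hw
  exact hw

/-- **THE LOCAL STEP, with closedness**: as `exists_localStep`, and moreover the partner `y'` of a CLOSED `x'` is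
CLOSED in `Y'` (the pro-open projections `P ×_X Spec 𝒪_{X,x} → P` are topological embeddings whose images contain every
point over `x`, and `Φ` is a homeomorphism). [cite: CossartJannsenSaito2020, p. 107, Def. 6.34 (i)]
[cite: GortzWedhorn2020, Prop. 13.91 (2)] -/
theorem exists_localStep_isClosed {Y Y' X X' : Scheme.{u}} {y : Y} (hy : IsClosed ({y} : Set Y)) {πY : Y' ⟶ Y}
    (hπY : IsBlowup πY (vanishingIdeal ⟨{y}, hy⟩)) {π : X' ⟶ X} {C : X.IdealSheafData} (hπ : IsBlowup π C)
    (hC : C = vanishingIdeal C.support) {x : X} (hx : stalkIdeal C x = maximalIdeal (X.presheaf.stalk x))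
    (e : Y.presheaf.stalk y ≅ X.presheaf.stalk x) {x' : X'} (hx' : π.base x' = x) (hcl : IsClosed ({x'} : Set X')) :
    ∃ y' : Y', πY.base y' = y ∧ IsClosed ({y'} : Set Y') ∧ Nonempty (Y'.presheaf.stalk y' ≅ X'.presheaf.stalk x') := by
  have hCY : vanishingIdeal (⟨{y}, hy⟩ : Closeds Y) = vanishingIdeal (vanishingIdeal (⟨{y}, hy⟩ : Closeds Y)).support :=
    vanishingIdeal_eq_vanishingIdeal_support _
  have hxY : stalkIdeal (vanishingIdeal (⟨{y}, hy⟩ : Closeds Y)) y = maximalIdeal (Y.presheaf.stalk y) :=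
    stalkIdeal_vanishingIdeal_singleton hy
  have hcY : (Y.fromSpecStalk y).base (closedPoint (Y.presheaf.stalk y)) = y := Scheme.fromSpecStalk_closedPoint
  have hcX : (X.fromSpecStalk x).base (closedPoint (X.presheaf.stalk x)) = x := Scheme.fromSpecStalk_closedPoint
  have hT := isBlowup_pullback_snd_fromSpecStalk_singleton hπY hCY hxY hcY
  have hW := isBlowup_pullback_snd_fromSpecStalk_singleton hπ hC hx hcX
  obtain ⟨Φ, hΦ⟩ := exists_iso_of_isBlowup_point_of_iso e rfl (isClosed_singleton_of_fromSpecStalk_eq hcY)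
    rfl (isClosed_singleton_of_fromSpecStalk_eq hcX) hT hW
  obtain ⟨zX, hzX, hzXc, hisoX⟩ := exists_lift_pullback_fromSpecStalk π x hx'
  subst hzX
  set zY : ↥(pullback πY (Y.fromSpecStalk y)) := Φ.inv.base zX with hzY
  have hid : Φ.hom.base zY = zX := by
    have h1 := congrArg (fun f => f.base zX) Φ.inv_hom_id
    simp only [Scheme.Hom.comp_base, TopCat.coe_comp, Function.comp_apply] at h1
    rw [hzY, h1]
    rfl
  -- over `y`
  have hover : πY.base ((pullback.fst πY (Y.fromSpecStalk y)).base zY) = y := by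
    have hsq : (pullback.snd π (X.fromSpecStalk x)).base zX =
        (Spec.map e.inv).base ((pullback.snd πY (Y.fromSpecStalk y)).base zY) := by
      have h := congrArg (fun f => f.base zY) hΦ
      simp only [Scheme.Hom.comp_base, TopCat.coe_comp, Function.comp_apply] at h
      rw [hid] at h
      exact h
    have hzXc' : (pullback.snd π (X.fromSpecStalk x)).base zX = closedPoint (X.presheaf.stalk x) :=
      eq_closedPoint_of_fromSpecStalk_eq hzXc
    have hzYc : (pullback.snd πY (Y.fromSpecStalk y)).base zY = closedPoint (Y.presheaf.stalk y) := by
      apply (Spec.map e.inv).isEmbedding.injective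
      rw [← hsq, hzXc']
      haveI : IsLocalHom e.inv.hom := isLocalHom_of_iso e.symm
      exact Spec_closedPoint.symm
    have hcond := congrArg (fun f => f.base zY) (pullback.condition (f := πY) (g := Y.fromSpecStalk y))
    simp only [Scheme.Hom.comp_base, TopCat.coe_comp, Function.comp_apply] at hcond
    rw [hcond, hzYc, Scheme.fromSpecStalk_closedPoint]
  refine ⟨(pullback.fst πY (Y.fromSpecStalk y)).base zY, hover, ?_, ?_⟩
  · -- closedness: `{zX}` closed (embedding `fst`), `{zY}` closed (homeomorphism `Φ`), `{y'}` closed (embedding `fst`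
    -- whose range contains every point over the closed `y`)
    have hzXcl : IsClosed ({zX} : Set ↥(pullback π (X.fromSpecStalk x))) := by
      have : ({zX} : Set ↥(pullback π (X.fromSpecStalk x))) =
          (pullback.fst π (X.fromSpecStalk x)).base ⁻¹' {(pullback.fst π (X.fromSpecStalk x)).base zX} := by
        ext w
        simp only [Set.mem_singleton_iff, Set.mem_preimage]
        exact ⟨fun h => by rw [h], fun h => (pullback.fst π (X.fromSpecStalk x)).isEmbedding.injective h⟩
      rw [this]
      exact hcl.preimage (pullback.fst π (X.fromSpecStalk x)).continuous
    have hzYcl : IsClosed ({zY} : Set ↥(pullback πY (Y.fromSpecStalk y))) := by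
      have : ({zY} : Set ↥(pullback πY (Y.fromSpecStalk y))) = Φ.hom.base ⁻¹' {zX} := by
        ext w
        simp only [Set.mem_singleton_iff, Set.mem_preimage]
        constructor
        · rintro rfl; exact hid
        · intro h
          have h2 := congrArg Φ.inv.base h
          have h3 := congrArg (fun f => f.base w) Φ.hom_inv_id
          simp only [Scheme.Hom.comp_base, TopCat.coe_comp, Function.comp_apply] at h3
          rw [h3] at h2
          rw [hzY, ← h2]
          rfl
      rw [this]
      exact hzXcl.preimage Φ.hom.continuous
    set fY := pullback.fst πY (Y.fromSpecStalk y) with hfY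
    apply isClosed_of_closure_subset
    intro w hw
    rw [Set.mem_singleton_iff]
    have hspec : fY.base zY ⤳ w := specializes_iff_mem_closure.mpr hw
    -- `w` lies over `y`, hence in the range of `fY`
    have hwy : πY.base w = y :=
      eq_of_specializes_of_isClosed hy (hover ▸ hspec.map πY.continuous)
    obtain ⟨w₀, hw₀⟩ := mem_range_pullback_fst_fromSpecStalk_of_eq πY y (x' := w) hwy
    rw [← hw₀] at hspec ⊢
    have hspec' : zY ⤳ w₀ := fY.isEmbedding.isInducing.specializes_iff.mp hspec
    have hw₀mem : w₀ ∈ closure ({zY} : Set _) := hspec'.mem_closure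
    rw [hzYcl.closure_eq, Set.mem_singleton_iff] at hw₀mem
    rw [hw₀mem]
  · haveI := isIso_stalkMap_pullback_fst_fromSpecStalk πY y zY
    haveI := hisoX
    exact ⟨asIso ((pullback.fst πY (Y.fromSpecStalk y)).stalkMap zY) ≪≫ asIso (Φ.inv.stalkMap zX) ≪≫
      (asIso ((pullback.fst π (X.fromSpecStalk x)).stalkMap zX)).symm⟩

end Summit.ResolutionOfSingularities.ResolutionOfSingularities.Theorems.SigmaMaxModificationsCorridor3.Moving

end
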